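/-
Copyright: cell `pub-ymgap` (HUMAN RULING D-0062), Track A of `YM-PLAN.md`, DAG node N20 (= NE7b); R134 acceleration seat
`pub-ymgap-dag-n20-d` (generation 3), module 5.  Released under the licence of the surrounding project.
-/
import Summits.QuantumFields.YangMills.Theorems.BalabanUVNodesN20LCSAvgExpMoment
import HarnessLib

/-!
# YM-DAG node N20 (= NE7b): THE PEIERLS WEIGHT PER LARGE-FIELD CELL OF THE ONCE-AVERAGED FIELD — from the plaquette-set sparseness of module 3
# to «every cell of a family contains a large plaquette of `Ū`», with weight `(m·e^{Cδ₀}·e^{−δ₀βε})^{#cells}` (the counting half of a Peierls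
# argument: one witness plaquette per cell, union bound over the `≤ m^{#cells}` choice functions)

Track A of `YM-PLAN.md` (cell `pub-ymgap`, HUMAN RULING D-0062), node **N20** = spine estimate NE7b (`T4WeightBudget.RelWeightBound`, NOT PRINTED,
NOT PROVED).  Seat `pub-ymgap-dag-n20-d` (R134), generation 3, module 5; kernel theorems only (0 `def`, 0 `sorry`, standard axioms); COUNT-NEUTRAL.

WHAT.  Large-field REGIONS of [Balaban1989LargeFieldI] §1 are unions of cubes each containing at least one large plaquette; NE7b's bad-class weight at the
first averaged level is charged per such CELL.  Module 3 (`N20LCSAvgExpMoment.gibbsMeasure_largeField_avgFun_le`) bounds the probability that a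
GIVEN set `Y` of level-1 plaquettes of `Ū = avgFun expMeanLogSU U` is entirely `ε`-large by `exp(C·δ₀·#Y)·exp(−δ₀·β·ε·#Y) = r^{#Y}`,
`r = e^{Cδ₀ − δ₀βε}`.  THIS FILE supplies the counting half:

* §1 **`measureReal_forall_exists_le_pow`** — GENERIC (any finite measure `μ`, events `E p`, a finite family of cells `𝒞` with pairwise DISJOINT
  witness sets `cells c` of size `≤ m`): if `μ{∀ p ∈ Y, E p} ≤ r^{#Y}` for every finite `Y` (`r ≥ 0`), then
  `μ{∀ c ∈ 𝒞, ∃ p ∈ cells c, E p} ≤ (m·r)^{#𝒞}` — the event lies in the union over the choice functions `f ∈ 𝒞.pi cells` of `{∀ c, E (f c)}`, each of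
  measure `≤ r^{#𝒞}` (the image of `f` has exactly `#𝒞` plaquettes by disjointness), and there are `∏_c #(cells c) ≤ m^{#𝒞}` of them;
* §2 **`gibbsMeasure_largeFieldCells_avgFun_le`** — the specialisation: with the `δ₀ > 0`, `C ≥ 0` of module 3, for every `d = 4` parameter set `P`
  (`P.L = L`, `1 ≤ m + K`), `β ≥ 4N`, threshold `ε`, and every finite family `𝒞` of cells with pairwise disjoint sets `cells c` of at most `m` level-1
  plaquettes, `gibbsMeasure P β {U | ∀ c ∈ 𝒞, ∃ p′ ∈ cells c, ε ≤ 1 − reTr Ū(∂p′)} ≤ (m · exp(C·δ₀ − δ₀·β·ε))^{#𝒞}` — per large-field cell of the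
  once-averaged field the weight `m·e^{Cδ₀}·e^{−δ₀βε}`, i.e. an extracted exponent `δ₀βε − Cδ₀ − log m` per cell (the level-1 analogue, for the
  averaging of record, of the `p₀(g)` per cube of [Balaban1989LargeFieldI] (0.1)); **`gibbsMeasure_largeFieldCells_dist1_avgFun_le`** — the same in
  the size currency `|Ū(∂p′) − 1| ≥ ε` (threshold `ε²∕(2N)`, module 3 v1.1);
* §3 **`gibbsMeasure_largeFieldCells_le`** — the same counting at LEVEL 0 for the raw field (seat `pub-ymgap-dag-n20-c`'s
  `N20LCSAtRecordLevelZero.gibbsMeasure_largeField_le` + §1): `≤ (m·exp(−(β·ε − C)∕12))^{#𝒞}` — print's `p₀(g)` per cube [Balaban1989LargeFieldI] (0.1)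
  in NODE 00's currency, cell by cell.

HONEST FRAMING.  The counting is [folklore]; the input is module 3's UNRESTRICTED level-0 bound (not the conditional LCS of n20-c's residual (ii));
first averaged level only; crude constants; the cells and their plaquette sets are PARAMETERS (Bałaban's cubes `□` of side `M` and their
plaquettes are the consumer's instance).  NE7b NOT PRINTED ∕ NOT PROVED; (α)-instance 0∕1; N20 NOT discharged; typed 28∕28, discharged count
untouched; one finite four-torus at fixed `ε` — NOT ℝ⁴, NOT infinite volume, NOT OS, NOT a mass gap, NOT Clay.

References: T. Bałaban, CMP 122 (1989) 175–202 [Balaban1989LargeFieldI] ((0.1) p.175, §1 large-field regions); CMP 109 (1987) 249–301 [Balaban1987RG1]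
((0.4) p.253).
-/

noncomputable section

open scoped BigOperators Matrix.Norms.L2Operator

namespace Summit.QuantumFields.YangMills.BalabanUVNodes.N20LCSAvgCellPeierls

open MeasureTheory
open Literature.MathematicalPhysics.QuantumFieldTheory.Balaban1983to89
open T4Continuum BlockAveraging ExpMeanLog
open Summit.QuantumFields.YangMills.BalabanUVNodes.N20LCSAvgExpMoment
  (gibbsMeasure_largeField_avgFun_le gibbsMeasure_largeField_dist1_avgFun_le)

/-! ## §1 The counting half of a Peierls argument: one witness per cell -/

section Counting

variable {Ω : Type*} [MeasurableSpace Ω] (μ : Measure Ω) [IsFiniteMeasure μ]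

/-- **ONE WITNESS PER CELL, UNION BOUND OVER THE CHOICE FUNCTIONS.**  Let `E p` be events, `𝒞` a finite family of cells with pairwise DISJOINT finite
witness sets `cells c`, each of size `≤ m`, and suppose every finite set `Y` of witnesses is simultaneously realised with probability `≤ r^{#Y}` (`r ≥ 0`).
Then `μ{ω | ∀ c ∈ 𝒞, ∃ p ∈ cells c, ω ∈ E p} ≤ (m·r)^{#𝒞}`. [folklore] -/
theorem measureReal_forall_exists_le_pow {κ π : Type*} [DecidableEq κ] [DecidableEq π] (E : π → Set Ω) (𝒞 : Finset κ)
    (cells : κ → Finset π) {m : ℕ} (hm : ∀ c ∈ 𝒞, (cells c).card ≤ m)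
    (hdisj : ∀ c₁ ∈ 𝒞, ∀ c₂ ∈ 𝒞, c₁ ≠ c₂ → Disjoint (cells c₁) (cells c₂))
    {r : ℝ} (hr : 0 ≤ r) (hY : ∀ Y : Finset π, μ.real {ω | ∀ p ∈ Y, ω ∈ E p} ≤ r ^ Y.card) :
    μ.real {ω | ∀ c ∈ 𝒞, ∃ p ∈ cells c, ω ∈ E p} ≤ ((m : ℝ) * r) ^ 𝒞.card := by
  classical
  -- the choice functions and their events
  set F := 𝒞.pi cells with hF
  let A : ((c : κ) → c ∈ 𝒞 → π) → Set Ω := fun f => {ω | ∀ (c : κ) (hc : c ∈ 𝒞), ω ∈ E (f c hc)}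
  -- the event lies in the union of the `A f`
  have hsub : {ω | ∀ c ∈ 𝒞, ∃ p ∈ cells c, ω ∈ E p} ⊆ ⋃ f ∈ F, A f := by
    intro ω hω
    simp only [Set.mem_setOf_eq] at hω
    choose g hg hE using hω
    exact Set.mem_biUnion (x := g) (Finset.mem_coe.mpr (Finset.mem_pi.mpr fun c hc => hg c hc)) fun c hc => hE c hc
  -- each `A f` is a simultaneous realisation of the `#𝒞` distinct witnesses `f c`
  have hA : ∀ f ∈ F, μ.real (A f) ≤ r ^ 𝒞.card := by
    intro f hf
    have hfmem : ∀ (c : κ) (hc : c ∈ 𝒞), f c hc ∈ cells c := fun c hc => Finset.mem_pi.mp hf c hc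
    set Y : Finset π := 𝒞.attach.image (fun c => f c.1 c.2) with hYdef
    have hAY : A f ⊆ {ω | ∀ p ∈ Y, ω ∈ E p} := by
      intro ω hω p hp
      obtain ⟨c, -, rfl⟩ := Finset.mem_image.mp hp
      exact hω c.1 c.2
    have hinj : Set.InjOn (fun c : {c // c ∈ 𝒞} => f c.1 c.2) ↑(𝒞.attach) := by
      intro c₁ _ c₂ _ h
      by_contra hne
      have hne' : c₁.1 ≠ c₂.1 := fun h' => hne (Subtype.ext h')
      have hd := hdisj c₁.1 c₁.2 c₂.1 c₂.2 hne'
      have h1 : f c₁.1 c₁.2 ∈ cells c₁.1 := hfmem _ _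
      have h2 : f c₁.1 c₁.2 ∈ cells c₂.1 := by
        have := hfmem c₂.1 c₂.2
        simp only at h
        rwa [← h] at this
      exact Finset.disjoint_left.mp hd h1 h2
    have hYcard : Y.card = 𝒞.card := by
      rw [hYdef, Finset.card_image_of_injOn hinj, Finset.card_attach]
    calc μ.real (A f) ≤ μ.real {ω | ∀ p ∈ Y, ω ∈ E p} := measureReal_mono hAY (measure_ne_top μ _)
      _ ≤ r ^ Y.card := hY Y
      _ = r ^ 𝒞.card := by rw [hYcard]
  -- the number of choice functions
  have hFcard : (F.card : ℝ) ≤ (m : ℝ) ^ 𝒞.card := by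
    have h : F.card ≤ m ^ 𝒞.card := by
      rw [hF, Finset.card_pi]
      exact Finset.prod_le_pow_card _ _ _ hm
    exact_mod_cast h
  calc μ.real {ω | ∀ c ∈ 𝒞, ∃ p ∈ cells c, ω ∈ E p} ≤ μ.real (⋃ f ∈ F, A f) := measureReal_mono hsub (measure_ne_top μ _)
    _ ≤ ∑ f ∈ F, μ.real (A f) := measureReal_biUnion_finset_le _ _
    _ ≤ ∑ _f ∈ F, r ^ 𝒞.card := Finset.sum_le_sum hA
    _ = F.card * r ^ 𝒞.card := by rw [Finset.sum_const, nsmul_eq_mul]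
    _ ≤ (m : ℝ) ^ 𝒞.card * r ^ 𝒞.card := mul_le_mul_of_nonneg_right hFcard (pow_nonneg hr _)
    _ = ((m : ℝ) * r) ^ 𝒞.card := by rw [mul_pow]

end Counting

/-! ## §2 The Peierls weight per large-field cell of the once-averaged field (`d = 4`, `SU(N)`, level-0 Gibbs measure) -/

section Cells

/-- Rewriting module 3's bound as a geometric weight: `exp(C·δ₀·n)·exp(−δ₀·β·ε·n) = (exp(C·δ₀ − δ₀·β·ε))^n`. [folklore] -/
theorem exp_mul_card_eq_pow (C δ₀ β ε : ℝ) (n : ℕ) :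
    Real.exp (C * δ₀ * n) * Real.exp (-(δ₀ * β * ε * n)) = Real.exp (C * δ₀ - δ₀ * β * ε) ^ n := by
  rw [← Real.exp_add, ← Real.exp_nat_mul]
  congr 1
  ring

/-- **THE PEIERLS WEIGHT PER LARGE-FIELD CELL OF `Ū`** (energy currency): with the `δ₀ > 0`, `C ≥ 0` of `N20LCSAvgExpMoment.localExpMoment_avgFun`, for
every `d = 4` parameter set `P` (`P.L = L`, `1 ≤ m + K`), every `β ≥ 4N`, every threshold `ε`, every finite family `𝒞` of cells with pairwise
disjoint sets `cells c` of at most `m` level-1 plaquettes: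
`gibbsMeasure P β {U | ∀ c ∈ 𝒞, ∃ p′ ∈ cells c, ε ≤ 1 − reTr Ū(∂p′)} ≤ (m·exp(C·δ₀ − δ₀·β·ε))^{#𝒞}`.
[cite: Balaban1989LargeFieldI, (0.1) p.175; Balaban1987RG1, (0.4) p.253] -/
theorem gibbsMeasure_largeFieldCells_avgFun_le (N : ℕ) [NeZero N] (L : ℕ) :
    ∃ δ₀ : ℝ, 0 < δ₀ ∧ ∃ C : ℝ, 0 ≤ C ∧ ∀ (P : Params), P.d = 4 → P.L = L → 1 ≤ P.m + P.K →
      ∀ (β : ℝ), 4 * N ≤ β → ∀ (ε : ℝ) {κ : Type} [DecidableEq κ] (𝒞 : Finset κ) (cells : κ → Finset (Plaq P 1)) (m : ℕ),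
        (∀ c ∈ 𝒞, (cells c).card ≤ m) → (∀ c₁ ∈ 𝒞, ∀ c₂ ∈ 𝒞, c₁ ≠ c₂ → Disjoint (cells c₁) (cells c₂)) →
        (T4GenFunBounds.gibbsMeasure P β : Measure (GaugeField P 0 (Matrix.specialUnitaryGroup (Fin N) ℂ))).real
            {U | ∀ c ∈ 𝒞, ∃ p ∈ cells c, ε ≤ 1 - reTr (GaugeField.plaqHol (avgFun (expMeanLogSU (n := Fin N)) U) p)} ≤
          ((m : ℝ) * Real.exp (C * δ₀ - δ₀ * β * ε)) ^ 𝒞.card := by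
  classical
  obtain ⟨δ₀, hδ₀, C, hC, h⟩ := gibbsMeasure_largeField_avgFun_le N L
  refine ⟨δ₀, hδ₀, C, hC, fun P hd hL hmK β hβ ε κ _ 𝒞 cells m hm hdisj => ?_⟩
  have hNpos : (0 : ℝ) < N := Nat.cast_pos.mpr (Nat.pos_of_ne_zero (NeZero.ne N))
  have hβ0 : 0 ≤ β := le_trans (by positivity) hβ
  haveI := T4GenFunBounds.isProbabilityMeasure_gibbsMeasure (G := Matrix.specialUnitaryGroup (Fin N) ℂ) P hβ0
  refine measureReal_forall_exists_le_pow _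
    (fun p => {U : GaugeField P 0 (Matrix.specialUnitaryGroup (Fin N) ℂ) |
      ε ≤ 1 - reTr (GaugeField.plaqHol (avgFun (expMeanLogSU (n := Fin N)) U) p)})
    𝒞 cells hm hdisj (Real.exp_pos _).le fun Y => ?_
  rw [← exp_mul_card_eq_pow]
  exact h P hd hL hmK β hβ ε Y

/-- **THE SAME IN THE SIZE CURRENCY** `|Ū(∂p′) − 1| ≥ ε` of [Balaban1987RG1]'s small-field conditions (threshold `ε²∕(2N)`; `ε ≥ 0`):
`gibbsMeasure P β {U | ∀ c ∈ 𝒞, ∃ p′ ∈ cells c, ε ≤ |Ū(∂p′) − 1|} ≤ (m·exp(C·δ₀ − δ₀·β·(ε²∕(2N))))^{#𝒞}`.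
[cite: Balaban1989LargeFieldI, (0.1) p.175; Balaban1987RG1, (0.4) p.253] -/
theorem gibbsMeasure_largeFieldCells_dist1_avgFun_le (N : ℕ) [NeZero N] (L : ℕ) :
    ∃ δ₀ : ℝ, 0 < δ₀ ∧ ∃ C : ℝ, 0 ≤ C ∧ ∀ (P : Params), P.d = 4 → P.L = L → 1 ≤ P.m + P.K →
      ∀ (β : ℝ), 4 * N ≤ β → ∀ (ε : ℝ), 0 ≤ ε → ∀ {κ : Type} [DecidableEq κ] (𝒞 : Finset κ) (cells : κ → Finset (Plaq P 1)) (m : ℕ),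
        (∀ c ∈ 𝒞, (cells c).card ≤ m) → (∀ c₁ ∈ 𝒞, ∀ c₂ ∈ 𝒞, c₁ ≠ c₂ → Disjoint (cells c₁) (cells c₂)) →
        (T4GenFunBounds.gibbsMeasure P β : Measure (GaugeField P 0 (Matrix.specialUnitaryGroup (Fin N) ℂ))).real
            {U | ∀ c ∈ 𝒞, ∃ p ∈ cells c, ε ≤ dist1 (GaugeField.plaqHol (avgFun (expMeanLogSU (n := Fin N)) U) p)} ≤
          ((m : ℝ) * Real.exp (C * δ₀ - δ₀ * β * (ε ^ 2 / (2 * (Fintype.card (Fin N) : ℝ))))) ^ 𝒞.card := by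
  classical
  obtain ⟨δ₀, hδ₀, C, hC, h⟩ := gibbsMeasure_largeField_dist1_avgFun_le N L
  refine ⟨δ₀, hδ₀, C, hC, fun P hd hL hmK β hβ ε hε κ _ 𝒞 cells m hm hdisj => ?_⟩
  have hNpos : (0 : ℝ) < N := Nat.cast_pos.mpr (Nat.pos_of_ne_zero (NeZero.ne N))
  have hβ0 : 0 ≤ β := le_trans (by positivity) hβ
  haveI := T4GenFunBounds.isProbabilityMeasure_gibbsMeasure (G := Matrix.specialUnitaryGroup (Fin N) ℂ) P hβ0
  refine measureReal_forall_exists_le_pow _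
    (fun p => {U : GaugeField P 0 (Matrix.specialUnitaryGroup (Fin N) ℂ) |
      ε ≤ dist1 (GaugeField.plaqHol (avgFun (expMeanLogSU (n := Fin N)) U) p)})
    𝒞 cells hm hdisj (Real.exp_pos _).le fun Y => ?_
  rw [← exp_mul_card_eq_pow]
  exact h P hd hL hmK β hβ ε hε Y

end Cells

/-! ## §3 The same counting at level 0 (the raw field; n20-c's `gibbsMeasure_largeField_le`) -/

section LevelZero

open Summit.QuantumFields.YangMills.BalabanUVNodes.N20LCSAtRecordLevelZero (gibbsMeasure_largeField_le)

/-- **THE PEIERLS WEIGHT PER LARGE-FIELD CELL OF THE RAW LEVEL-0 FIELD** (print's `p₀(g)`-extraction [Balaban1989LargeFieldI] (0.1), per CELL, in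
NODE 00's currency): with the constant `C` of `N20LCSAtRecordLevelZero.localExpMoment_gibbsMeasure`, for every `d = 4` parameter set `P`, every
`β ≥ 4N`, every threshold `ε` and every finite family `𝒞` of cells with pairwise disjoint sets `cells c` of at most `m` level-0 plaquettes,
`gibbsMeasure P β {U | ∀ c ∈ 𝒞, ∃ p ∈ cells c, ε ≤ 1 − reTr U(∂p)} ≤ (m·exp(−(β·ε − C)∕12))^{#𝒞}` (seat `pub-ymgap-dag-n20-c`'s
`gibbsMeasure_largeField_le` + §1). [cite: Balaban1989LargeFieldI, (0.1) p.175] -/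
theorem gibbsMeasure_largeFieldCells_le (N : ℕ) [NeZero N] :
    ∃ C : ℝ, 0 ≤ C ∧ ∀ (P : Params), P.d = 4 → ∀ (β : ℝ), 4 * N ≤ β →
      ∀ (ε : ℝ) {κ : Type} [DecidableEq κ] (𝒞 : Finset κ) (cells : κ → Finset (Plaq P 0)) (m : ℕ),
        (∀ c ∈ 𝒞, (cells c).card ≤ m) → (∀ c₁ ∈ 𝒞, ∀ c₂ ∈ 𝒞, c₁ ≠ c₂ → Disjoint (cells c₁) (cells c₂)) →
        (T4GenFunBounds.gibbsMeasure P β : Measure (GaugeField P 0 (Matrix.specialUnitaryGroup (Fin N) ℂ))).real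
            {U | ∀ c ∈ 𝒞, ∃ p ∈ cells c, ε ≤ 1 - reTr (GaugeField.plaqHol U p)} ≤
          ((m : ℝ) * Real.exp (-((β * ε - C) / 12))) ^ 𝒞.card := by
  classical
  obtain ⟨C, hC, h⟩ := gibbsMeasure_largeField_le N
  refine ⟨C, hC, fun P hd β hβ ε κ _ 𝒞 cells m hm hdisj => ?_⟩
  have hNpos : (0 : ℝ) < N := Nat.cast_pos.mpr (Nat.pos_of_ne_zero (NeZero.ne N))
  have hβ0 : 0 ≤ β := le_trans (by positivity) hβ
  haveI := T4GenFunBounds.isProbabilityMeasure_gibbsMeasure (G := Matrix.specialUnitaryGroup (Fin N) ℂ) P hβ0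
  refine measureReal_forall_exists_le_pow _
    (fun p => {U : GaugeField P 0 (Matrix.specialUnitaryGroup (Fin N) ℂ) | ε ≤ 1 - reTr (GaugeField.plaqHol U p)})
    𝒞 cells hm hdisj (Real.exp_pos _).le fun Y => ?_
  -- `exp(−(a·#Y)) = (exp(−a))^{#Y}` (the tree's `…StubHereditaryOfCondFamilies.exp_neg_mul_natCast`, inlined to keep the imports local)
  have hrw : Real.exp (-((β * ε - C) / 12 * Y.card)) = Real.exp (-((β * ε - C) / 12)) ^ Y.card := by
    rw [← Real.exp_nat_mul]; congr 1; ring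
  rw [← hrw]
  exact h P hd β hβ ε Y

end LevelZero

end Summit.QuantumFields.YangMills.BalabanUVNodes.N20LCSAvgCellPeierls

end
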